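import Summits.CriticalPhenomena.SAWScalingLimit.Theorems.SAWMassiveIsingTiltDefs
import HarnessLib

/-!
# Crux `MassiveWindowSLE` (stmt-CriticalPhenomena-7685), line `registered`, skeleton r9 — sanity of the
# schedule side conditions of S1': fast RATE-schedules EXIST given sharpness of the honeycomb transition

The open stub S1' `stub_covariantSimpleRateWindowLimit` asks for a window schedule `m` that is FAST
(`m δ·δ → 0`, `m δ / log δ⁻¹ → ∞`) and carries a RATE `c` (`c δ / (δ log δ⁻¹) → ∞` and the uniform
finite-volume exponential bound on the honeycomb loop-`O(1)` two-point function at the window weight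
`y(δ) = 1/√3 − m(δ)δ` with rate `c(δ)`). This file proves that these side conditions are JOINTLY
SATISFIABLE, together with `m → ∞`, as soon as the honeycomb loop/Ising model is SHARP below `y_c = 1/√3`:
for every `0 ≤ y < 1/√3` some rate `c > 0` bounds `W_Λ(u,v; y) ≤ e^{-c |c(u)−c(v)|} Zloop_Λ(y)` uniformly
(Cimasoni–Duminil-Copin, EJP 18 (2013) no. 44, Thm 1.1: `tanh β_c(hexagonal) = 1/√3`;
Aizenman–Barsky–Fernández, J. Stat. Phys. 47 (1987) 343 / Duminil-Copin–Raoufi–Tassion, Ann. of Math. 189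
(2019) 75: exponential decay for `β < β_c`; finite-volume free correlations are dominated by the
infinite-volume ones by GKS). So the RATE re-parametrisation of r7 does not make S1' vacuous or
unsatisfiable: slowly closing windows (piecewise-constant `y(δ) = y_n` on a scale of meshes `δ ≤ δ_n`
chosen after the rates `c(y_n)`) are fast RATE-schedules. Pure real analysis; sharpness enters as an
explicit hypothesis (it is not in the tree for the honeycomb lattice).
-/

namespace Summit.CriticalPhenomena.SAWScalingLimit.Cruxes.MassiveWindowSLE.Birth

open Filter Set Topology
open Literature.Probability Literature.Probability.LatticeModels

/-- `δ log δ⁻¹ ≤ 2 √δ` for `0 < δ`. -/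
theorem sched_mul_log_inv_le {δ : ℝ} (hδ : 0 < δ) : δ * Real.log δ⁻¹ ≤ 2 * Real.sqrt δ := by
  have hs : 0 < Real.sqrt δ := Real.sqrt_pos.2 hδ
  have h1 : Real.log δ⁻¹ = 2 * Real.log (Real.sqrt δ)⁻¹ := by
    rw [Real.log_inv, Real.log_inv, Real.log_sqrt hδ.le]
    ring
  have h2 : Real.log (Real.sqrt δ)⁻¹ ≤ (Real.sqrt δ)⁻¹ :=
    (Real.log_le_sub_one_of_pos (inv_pos.2 hs)).trans (by linarith)
  calc δ * Real.log δ⁻¹ = δ * (2 * Real.log (Real.sqrt δ)⁻¹) := by rw [h1]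
    _ ≤ δ * (2 * (Real.sqrt δ)⁻¹) := by gcongr
    _ = 2 * Real.sqrt δ := by
        have h3 : δ * (Real.sqrt δ)⁻¹ = Real.sqrt δ := by
          rw [mul_inv_eq_iff_eq_mul₀ hs.ne', Real.mul_self_sqrt hδ.le]
        calc δ * (2 * (Real.sqrt δ)⁻¹) = 2 * (δ * (Real.sqrt δ)⁻¹) := by ring
          _ = 2 * Real.sqrt δ := by rw [h3]

/-- **Fast RATE-schedules exist given sharpness below `y_c`.** -/
theorem exists_fastRateSchedule_of_sharp
    (hsharp : ∀ y : ℝ, 0 ≤ y → y < (Real.sqrt 3)⁻¹ → ∃ c : ℝ, 0 < c ∧ ∀ (Λ : Finset Literature.Probability.LatticeModels.HexVertex) (u v : Literature.Probability.LatticeModels.HexVertex), u ∈ Λ → v ∈ Λ → u ≠ v → (∑ᶠ E ∈ {E : Finset (Sym2 Literature.Probability.LatticeModels.HexVertex) | (∀ e ∈ E, e ∈ (Literature.Probability.LatticeModels.hexGraph).edgeSet ∧ ∀ w ∈ e, w ∈ (↑Λ : Set Literature.Probability.LatticeModels.HexVertex)) ∧ ∀ w : Literature.Probability.LatticeModels.HexVertex,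 (Odd (E.filter (fun e => w ∈ e)).card ↔ (w = u ∨ w = v))}, y ^ E.card) ≤ Real.exp (-(c * dist (Literature.Probability.LatticeModels.hexCenter u) (Literature.Probability.LatticeModels.hexCenter v))) * Summit.CriticalPhenomena.SAWScalingLimit.Theorems.SAWMassiveIsingTilt.Zloop Literature.Probability.LatticeModels.hexGraph (↑Λ : Set Literature.Probability.LatticeModels.HexVertex) y) :
    ∃ m c : ℝ → ℝ, (Filter.Tendsto (fun δ => m δ * δ) (nhdsWithin 0 (Set.Ioi 0)) (nhds 0) ∧ Filter.Tendsto (fun δ => m δ / Real.log δ⁻¹) (nhdsWithin 0 (Set.Ioi 0)) Filter.atTop) ∧ Filter.Tendsto m (nhdsWithin 0 (Set.Ioi 0)) Filter.atTop ∧ (Filter.Tendsto (fun δ => c δ / (δ * Real.log δ⁻¹)) (nhdsWithin 0 (Set.Ioi 0)) Filter.atTop ∧ ∀ᶠ δ in nhdsWithin 0 (Set.Ioi 0), ∀ (Λ : Finset Literature.Probability.LatticeModels.HexVertex) (u v : Literature.Probability.LatticeModels.HexVertex), u ∈ Λ → v ∈ Λ → u ≠ v → (∑ᶠ E ∈ {E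 : Finset (Sym2 Literature.Probability.LatticeModels.HexVertex) | (∀ e ∈ E, e ∈ (Literature.Probability.LatticeModels.hexGraph).edgeSet ∧ ∀ w ∈ e, w ∈ (↑Λ : Set Literature.Probability.LatticeModels.HexVertex)) ∧ ∀ w : Literature.Probability.LatticeModels.HexVertex, (Odd (E.filter (fun e => w ∈ e)).card ↔ (w = u ∨ w = v))}, ((Real.sqrt 3)⁻¹ - m δ * δ) ^ E.card) ≤ Real.exp (-(c δ * dist (Literature.Probability.LatticeModels.hexCenter u) (Literature.Probability.LatticeModels.hexCenter v))) * Summit.CriticalPhenomena.SAWScalingLimit.Theorems.SAWMassiveIsingTilt.Zloop Literature.Probability.LatticeModels.hexGraph (↑Λ : Set Literature.Probability.LatticeModels.HexVertex) ((Real.sqrt 3)⁻¹ - m δ * δ)) := by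
  classical
  set yc : ℝ := (Real.sqrt 3)⁻¹ with hyc
  have hs3 : Real.sqrt 3 < 2 := by
    rw [Real.sqrt_lt' (by norm_num)]
    norm_num
  have hyc_half : (1 : ℝ) / 2 < yc := by
    rw [hyc, one_div, inv_lt_inv₀ (by norm_num) (Real.sqrt_pos.2 (by norm_num))]
    exact hs3
  -- the levels `y_n = y_c − 1/(n+2)` and their rates
  let yN : ℕ → ℝ := fun n => yc - 1 / ((n : ℝ) + 2)
  have hfrac : ∀ n : ℕ, 0 < 1 / ((n : ℝ) + 2) ∧ 1 / ((n : ℝ) + 2) ≤ 1 / 2 := fun n =>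
    ⟨by positivity, by
      rw [div_le_div_iff₀ (by positivity) (by norm_num)]
      have : (0 : ℝ) ≤ n := Nat.cast_nonneg n
      linarith⟩
  have hyN0 : ∀ n, 0 ≤ yN n := fun n => by
    have := (hfrac n).2
    show 0 ≤ yc - 1 / ((n : ℝ) + 2)
    linarith
  have hyN1 : ∀ n, yN n < yc := fun n => by
    have := (hfrac n).1
    show yc - 1 / ((n : ℝ) + 2) < yc
    linarith
  choose cN hcN_pos hcN using fun n => hsharp (yN n) (hyN0 n) (hyN1 n)
  -- thresholds `θ_n` and the non-increasing scale `δ_n = min_{k ≤ n} θ_k`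
  let θ : ℕ → ℝ := fun n => min (1 / ((n : ℝ) + 2) ^ 4) ((cN n / ((n : ℝ) + 2)) ^ 2)
  have hθ_pos : ∀ n, 0 < θ n := fun n =>
    lt_min (by positivity) (pow_pos (div_pos (hcN_pos n) (by positivity)) 2)
  let dN : ℕ → ℝ := fun n => (Finset.range (n + 1)).inf' ⟨0, by simp⟩ θ
  have hdN_le : ∀ n k, k ≤ n → dN n ≤ θ k := fun n k hk =>
    Finset.inf'_le _ (Finset.mem_range.2 (Nat.lt_succ_of_le hk))
  have hdN_pos : ∀ n, 0 < dN n := fun n => by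
    show 0 < (Finset.range (n + 1)).inf' ⟨0, by simp⟩ θ
    rw [Finset.lt_inf'_iff]
    exact fun k _ => hθ_pos k
  have hdN_succ : ∀ n, dN (n + 1) ≤ dN n := fun n => by
    show (Finset.range (n + 1 + 1)).inf' ⟨0, by simp⟩ θ ≤ (Finset.range (n + 1)).inf' ⟨0, by simp⟩ θ
    exact Finset.inf'_mono θ (Finset.range_mono (by omega)) _
  have hdN_anti : Antitone dN := antitone_nat_of_succ_le hdN_succ
  have hdN_small : ∀ n, dN n ≤ 1 / ((n : ℝ) + 2) ^ 4 := fun n =>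
    (hdN_le n n le_rfl).trans (min_le_left _ _)
  have hdN_rate : ∀ n, dN n ≤ (cN n / ((n : ℝ) + 2)) ^ 2 := fun n =>
    (hdN_le n n le_rfl).trans (min_le_right _ _)
  -- the index `N δ`: least `n` with `δ_{n+1} < δ`
  have hex : ∀ δ : ℝ, 0 < δ → ∃ n : ℕ, dN (n + 1) < δ := fun δ hδ => by
    obtain ⟨n, hn⟩ := exists_nat_gt (1 / δ)
    refine ⟨n, (hdN_small (n + 1)).trans_lt ?_⟩
    have h1 : (1 : ℝ) ≤ ((n : ℝ) + 1 + 2) ^ 3 := one_le_pow₀ (by linarith [Nat.cast_nonneg (α := ℝ) n])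
    have h2 : 1 / δ < ((n : ℝ) + 1 + 2) := by linarith
    have hδ' : 1 / ((n : ℝ) + 1 + 2) < δ := by
      rw [div_lt_iff₀ (by positivity)]
      rw [div_lt_iff₀ hδ] at h2
      linarith
    calc 1 / (((n + 1 : ℕ) : ℝ) + 2) ^ 4 = 1 / ((n : ℝ) + 1 + 2) ^ 4 := by push_cast; ring
      _ ≤ 1 / ((n : ℝ) + 1 + 2) := by
          rw [div_le_div_iff₀ (by positivity) (by positivity), one_mul, one_mul]
          calc ((n : ℝ) + 1 + 2) = ((n : ℝ) + 1 + 2) * 1 := (mul_one _).symm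
            _ ≤ ((n : ℝ) + 1 + 2) * ((n : ℝ) + 1 + 2) ^ 3 := by gcongr
            _ = ((n : ℝ) + 1 + 2) ^ 4 := by ring
      _ < δ := hδ'
  let N : ℝ → ℕ := fun δ => if h : 0 < δ then Nat.find (hex δ h) else 0
  have hN_spec : ∀ δ, 0 < δ → dN (N δ + 1) < δ := fun δ hδ => by
    show dN ((if h : 0 < δ then Nat.find (hex δ h) else 0) + 1) < δ
    rw [dif_pos hδ]
    exact Nat.find_spec (hex δ hδ)
  have hN_min : ∀ δ, 0 < δ → ∀ n, n < N δ → δ ≤ dN (n + 1) := fun δ hδ n hn => by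
    have hn' : n < Nat.find (hex δ hδ) := by
      have : N δ = Nat.find (hex δ hδ) := dif_pos hδ
      rwa [this] at hn
    exact not_lt.1 (Nat.find_min (hex δ hδ) hn')
  have hN_large : ∀ (K : ℕ) (δ : ℝ), 0 < δ → δ ≤ dN (K + 1) → K < N δ := fun K δ hδ hK => by
    by_contra h
    have hle : N δ ≤ K := not_lt.1 h
    have := hN_spec δ hδ
    have hmono : dN (K + 1) ≤ dN (N δ + 1) := hdN_anti (by omega)
    linarith
  have hN_le : ∀ δ, 0 < δ → 1 ≤ N δ → δ ≤ dN (N δ) := fun δ hδ h1 => by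
    have := hN_min δ hδ (N δ - 1) (by omega)
    rwa [Nat.sub_add_cancel h1] at this
  -- `N δ → ∞` along `𝓝[>] 0`
  have hN_tendsto : Tendsto (fun δ => (N δ : ℝ)) (𝓝[>] (0 : ℝ)) atTop := by
    rw [tendsto_atTop]
    intro b
    obtain ⟨K, hK⟩ := exists_nat_ge b
    have hev : ∀ᶠ δ in 𝓝[>] (0 : ℝ), δ ∈ Set.Ioo 0 (dN (K + 1)) := Ioo_mem_nhdsGT (hdN_pos _)
    filter_upwards [hev] with δ hδ
    have := hN_large K δ hδ.1 hδ.2.le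
    calc b ≤ K := hK
      _ ≤ (N δ : ℝ) := by exact_mod_cast this.le
  have hN_ge_one : ∀ᶠ δ in 𝓝[>] (0 : ℝ), 1 ≤ N δ ∧ 0 < δ ∧ δ < 1 := by
    have hev : ∀ᶠ δ in 𝓝[>] (0 : ℝ), δ ∈ Set.Ioo 0 (min (dN 1) 1) :=
      Ioo_mem_nhdsGT (lt_min (hdN_pos _) one_pos)
    filter_upwards [hev] with δ hδ
    refine ⟨?_, hδ.1, hδ.2.trans_le (min_le_right _ _)⟩
    exact Nat.succ_le_of_lt (hN_large 0 δ hδ.1 (hδ.2.le.trans (min_le_left _ _)))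
  -- the schedule
  let m : ℝ → ℝ := fun δ => 1 / (((N δ : ℝ) + 2) * δ)
  let c : ℝ → ℝ := fun δ => cN (N δ)
  have hmδ : ∀ δ, 0 < δ → m δ * δ = 1 / ((N δ : ℝ) + 2) := fun δ hδ => by
    show 1 / (((N δ : ℝ) + 2) * δ) * δ = 1 / ((N δ : ℝ) + 2)
    field_simp
  -- key lower bounds on the good set
  have hsqrt_le : ∀ δ, 0 < δ → 1 ≤ N δ → Real.sqrt δ ≤ 1 / ((N δ : ℝ) + 2) ^ 2 ∧
      Real.sqrt δ ≤ cN (N δ) / ((N δ : ℝ) + 2) := fun δ hδ h1 => by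
    have hle := hN_le δ hδ h1
    constructor
    · have h4 : (1 : ℝ) / ((N δ : ℝ) + 2) ^ 4 = (1 / ((N δ : ℝ) + 2) ^ 2) ^ 2 := by
        rw [div_pow, one_pow, ← pow_mul]
      calc Real.sqrt δ ≤ Real.sqrt ((1 / ((N δ : ℝ) + 2) ^ 2) ^ 2) :=
            Real.sqrt_le_sqrt (by rw [← h4]; exact hle.trans (hdN_small _))
        _ = 1 / ((N δ : ℝ) + 2) ^ 2 := Real.sqrt_sq (by positivity)
    · calc Real.sqrt δ ≤ Real.sqrt ((cN (N δ) / ((N δ : ℝ) + 2)) ^ 2) :=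
            Real.sqrt_le_sqrt (hle.trans (hdN_rate _))
        _ = cN (N δ) / ((N δ : ℝ) + 2) := Real.sqrt_sq (div_pos (hcN_pos _) (by positivity)).le
  refine ⟨m, c, ⟨?_, ?_⟩, ?_, ?_, ?_⟩
  · -- `m δ · δ = 1/(N δ + 2) → 0`
    have h : Tendsto (fun δ => ((N δ : ℝ) + 2)⁻¹) (𝓝[>] (0 : ℝ)) (𝓝 0) :=
      tendsto_inv_atTop_zero.comp (tendsto_atTop_add_const_right _ 2 hN_tendsto)
    refine h.congr' ?_
    filter_upwards [hN_ge_one] with δ hδ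
    rw [hmδ δ hδ.2.1, one_div]
  · -- fastness: `m δ / log δ⁻¹ ≥ (N δ + 2)/2`
    refine tendsto_atTop_mono' _ ?_
      ((tendsto_atTop_add_const_right _ 2 hN_tendsto).atTop_div_const (r := 2) two_pos)
    filter_upwards [hN_ge_one] with δ ⟨h1, hδ, hδ1⟩
    have hlog : 0 < Real.log δ⁻¹ := Real.log_pos ((one_lt_inv₀ hδ).2 hδ1)
    have hkey : ((N δ : ℝ) + 2) * δ * Real.log δ⁻¹ ≤ 2 / ((N δ : ℝ) + 2) := by
      calc ((N δ : ℝ) + 2) * δ * Real.log δ⁻¹ = ((N δ : ℝ) + 2) * (δ * Real.log δ⁻¹) := by ring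
        _ ≤ ((N δ : ℝ) + 2) * (2 * Real.sqrt δ) :=
            mul_le_mul_of_nonneg_left (sched_mul_log_inv_le hδ) (by positivity)
        _ ≤ ((N δ : ℝ) + 2) * (2 * (1 / ((N δ : ℝ) + 2) ^ 2)) :=
            mul_le_mul_of_nonneg_left (mul_le_mul_of_nonneg_left (hsqrt_le δ hδ h1).1 zero_le_two)
              (by positivity)
        _ = 2 / ((N δ : ℝ) + 2) := by field_simp; try ring
    have hpos : 0 < ((N δ : ℝ) + 2) * δ * Real.log δ⁻¹ := by positivity
    show ((N δ : ℝ) + 2) / 2 ≤ 1 / (((N δ : ℝ) + 2) * δ) / Real.log δ⁻¹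
    rw [div_div, div_le_div_iff₀ two_pos hpos, one_mul]
    calc ((N δ : ℝ) + 2) * (((N δ : ℝ) + 2) * δ * Real.log δ⁻¹)
        ≤ ((N δ : ℝ) + 2) * (2 / ((N δ : ℝ) + 2)) := mul_le_mul_of_nonneg_left hkey (by positivity)
      _ = 2 := by field_simp
  · -- `m → ∞`: `m δ ≥ N δ + 2`
    refine tendsto_atTop_mono' _ ?_ (tendsto_atTop_add_const_right _ 2 hN_tendsto)
    filter_upwards [hN_ge_one] with δ ⟨h1, hδ, _⟩
    have hle : δ ≤ 1 / ((N δ : ℝ) + 2) ^ 4 := (hN_le δ hδ h1).trans (hdN_small _)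
    show (N δ : ℝ) + 2 ≤ 1 / (((N δ : ℝ) + 2) * δ)
    rw [le_div_iff₀ (by positivity)]
    calc ((N δ : ℝ) + 2) * (((N δ : ℝ) + 2) * δ) = ((N δ : ℝ) + 2) ^ 2 * δ := by ring
      _ ≤ ((N δ : ℝ) + 2) ^ 2 * (1 / ((N δ : ℝ) + 2) ^ 4) := by gcongr
      _ = 1 / ((N δ : ℝ) + 2) ^ 2 := by
          rw [mul_one_div, div_eq_div_iff (by positivity) (by positivity)]
          ring
      _ ≤ 1 := by
          rw [div_le_one (by positivity)]
          exact one_le_pow₀ (by linarith [Nat.cast_nonneg (α := ℝ) (N δ)])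
  · -- RATE growth: `c δ / (δ log δ⁻¹) ≥ (N δ + 2)/2`
    refine tendsto_atTop_mono' _ ?_
      ((tendsto_atTop_add_const_right _ 2 hN_tendsto).atTop_div_const (r := 2) two_pos)
    filter_upwards [hN_ge_one] with δ ⟨h1, hδ, hδ1⟩
    have hlog : 0 < Real.log δ⁻¹ := Real.log_pos ((one_lt_inv₀ hδ).2 hδ1)
    have hkey : δ * Real.log δ⁻¹ ≤ 2 * (cN (N δ) / ((N δ : ℝ) + 2)) :=
      (sched_mul_log_inv_le hδ).trans (mul_le_mul_of_nonneg_left (hsqrt_le δ hδ h1).2 zero_le_two)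
    have hpos : 0 < δ * Real.log δ⁻¹ := by positivity
    show ((N δ : ℝ) + 2) / 2 ≤ cN (N δ) / (δ * Real.log δ⁻¹)
    rw [div_le_div_iff₀ two_pos hpos]
    have hc := hcN_pos (N δ)
    calc ((N δ : ℝ) + 2) * (δ * Real.log δ⁻¹) ≤ ((N δ : ℝ) + 2) * (2 * (cN (N δ) / ((N δ : ℝ) + 2))) :=
          mul_le_mul_of_nonneg_left hkey (by positivity)
      _ = cN (N δ) * 2 := by field_simp; try ring
  · -- the RATE decay clause holds for EVERY `δ > 0` (level `y_{N δ}`, rate `c(y_{N δ})`)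
    filter_upwards [self_mem_nhdsWithin] with δ hδ
    rw [Set.mem_Ioi] at hδ
    intro Λ u v hu hv huv
    have hy : (Real.sqrt 3)⁻¹ - m δ * δ = yN (N δ) := by
      rw [hmδ δ hδ]
    rw [hy]
    exact hcN (N δ) Λ u v hu hv huv

end Summit.CriticalPhenomena.SAWScalingLimit.Cruxes.MassiveWindowSLE.Birth
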